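import Mathlib.Analysis.Complex.UpperHalfPlane.Measure
import Mathlib.Analysis.Complex.UpperHalfPlane.MoebiusAction
import Mathlib.Analysis.SpecialFunctions.Trigonometric.Angle
import Mathlib.Analysis.SpecialFunctions.Complex.Arg
import Mathlib.Analysis.SpecialFunctions.Complex.Circle
import Mathlib.MeasureTheory.Function.SpecialFunctions.Basic
import Mathlib.MeasureTheory.Integral.IntervalIntegral.Periodic
import Mathlib.MeasureTheory.Measure.Prod
import HarnessLib

/-!
# The Haar measure of `SL₂^±(ℝ)` in Iwasawa coordinates `ℍ × SO(2)`

Topic `Literature/MeasureTheory/Group`. Everything in this file is PROVED (no named facts).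

For the counting of `GL₂(ℤ)`-orbits of binary forms by the averaging method of
Bhargava–Shankar (Ann. of Math. 181 (2015), §2.3: "`dg = t⁻² dn d^×t dk` ... an invariant
measure on `G`") one needs a concrete left Haar measure on `SL₂(ℝ)` (and on
`SL₂^±(ℝ) = {det = ±1} ⊃ GL₂(ℤ)`) written in Iwasawa coordinates, together with its left
invariance. Mathlib has the `GL₂(ℝ)`-invariant hyperbolic measure `dx dy / y²` on `ℍ`
(`UpperHalfPlane.volume`, `SMulInvariantMeasure (GL (Fin 2) ℝ) ℍ volume`) and the Haar measure
of the circle `AddCircle (2π)`; this file assembles from them the Haar measure of `SL₂(ℝ)`: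

* `iwasawa (z, θ) = s(z) k(θ)` with `s(x + iy) = (√y, x/√y; 0, 1/√y)` (so `s(z) • i = z`) and
  `k(θ) = (cos θ, sin θ; −sin θ, cos θ)`, a bijection `ℍ × ℝ/2πℤ → SL₂(ℝ)`
  (`eq_iwasawa`, `iwasawa_injective`, `range_iwasawa`), with inverse coordinates
  `x(g) + i y(g) = g • i`, `θ(g) = arg(d − ic)` (`xOf`, `yOf`, `angleOf`);
* **equivariance** `h · s(z) k(θ) = s(h • z) · k(θ(h s(z)) + θ)` (`mul_iwasawa`): in these
  coordinates left multiplication by `h ∈ SL₂(ℝ)` is the skew product `skewMap h` over the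
  Möbius action, hence **measure preserving** for `vol_ℍ ⊗ dθ`
  (`measurePreserving_skewMap`, from Mathlib's invariance of `vol_ℍ` and translation invariance
  on the circle, via `MeasurePreserving.skew_product`);
* `iwasawaMeasure = iwasawa_* (vol_ℍ ⊗ dθ)`, a measure on `M₂(ℝ)` carried by `SL₂(ℝ)`
  (density `y⁻² dx dy dθ`), **left invariant under `SL₂(ℝ)`** (`map_mul_left_iwasawaMeasure`);
  `haarSL2pm = iwasawaMeasure + σ_* iwasawaMeasure` (`σ = diag(1, −1)`), carried by
  `{det = ±1}` and **left invariant under every matrix of determinant `±1`**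
  (`map_mul_left_haarSL2pm`, `haarSL2pm_preimage_mul_left`);
* **volumes**: `haarSL2pm {g ∈ SL₂(ℝ) : g • i ∈ A, θ(g) ∈ Θ} = vol_ℍ(A) · |Θ|`
  (`haarSL2pm_coordSet`), `vol_ℍ(A) = ∫_A dx dy / y²` (`volume_coe_preimage`), and the length
  of an arc `|[a, b)| = b − a` (`volume_arc`). With `A` the modular fundamental domain
  (`vol = π/3`) and `Θ = [0, π)` this gives `π²/3` for the Gauss fundamental domain of
  `GL₂(ℤ)\SL₂^±(ℝ)` (twice Bhargava–Shankar's `ζ(2)`: their `dg` is half of ours).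

Angles live in `AddCircle (2π)` (which carries Mathlib's measure space structure; `Real.Angle`
is the same type by definition and its trigonometric API is transferred, `cosA_add` etc.). The
measurable structure on `M₂(ℝ)` is a hypothesis `[MeasurableSpace] [BorelSpace]` (no global
instance is registered on the Mathlib type `Matrix`).

## References

* M. Bhargava, A. Shankar, *Binary quartic forms having bounded invariants, and the boundedness
  of the average rank of elliptic curves*, Ann. of Math. (2) 181 (2015) 191–242, §2.1 and §2.3
  (`F = N'A'KΛ`, `dg = t⁻² dn d^×t dk`; arXiv:1006.1002v2 numbering).
  [cite: BhargavaShankarAnnals2015, §2.3 (the invariant measure dg; arXiv:1006.1002v2 numbering)]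
* S. Lang, *SL₂(ℝ)*, GTM 105, Springer 1985, Ch. III §1 (Iwasawa decomposition and Haar
  measure `y⁻² dx dy dθ`). [folklore]
-/

noncomputable section

open MeasureTheory Complex
open scoped MatrixGroups Real UpperHalfPlane

namespace Literature.MeasureTheory.Group

/-! ## The angle group `ℝ/2πℤ = AddCircle (2π)` -/

/-- `0 < 2π`, as a `Fact` (needed for the Haar probability-type measure on `AddCircle (2π)`,
of total mass `2π`). [folklore] -/
theorem fact_two_pi_pos : Fact (0 < 2 * π) := ⟨Real.two_pi_pos⟩

attribute [local instance] fact_two_pi_pos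

/-! ## Trigonometry on `AddCircle (2π)`

`Real.Angle` is by definition `AddCircle (2π)`, but only the latter carries Mathlib's measure
space structure; we use `AddCircle (2π)` as the type of angles and transfer the trigonometric
API of `Real.Angle` along the definitional equality (term-mode proofs). -/

/-- `cos (θ₁ + θ₂)` on `AddCircle (2π)`. [folklore] -/
theorem cosA_add (θ₁ θ₂ : AddCircle (2 * π)) :
    Real.Angle.cos (θ₁ + θ₂) =
      Real.Angle.cos θ₁ * Real.Angle.cos θ₂ - Real.Angle.sin θ₁ * Real.Angle.sin θ₂ :=
  Real.Angle.cos_add θ₁ θ₂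

/-- `sin (θ₁ + θ₂)` on `AddCircle (2π)`. [folklore] -/
theorem sinA_add (θ₁ θ₂ : AddCircle (2 * π)) :
    Real.Angle.sin (θ₁ + θ₂) =
      Real.Angle.sin θ₁ * Real.Angle.cos θ₂ + Real.Angle.cos θ₁ * Real.Angle.sin θ₂ :=
  Real.Angle.sin_add θ₁ θ₂

/-- `cos² + sin² = 1` on `AddCircle (2π)`. [folklore] -/
theorem cosA_sq_add_sinA_sq (θ : AddCircle (2 * π)) :
    Real.Angle.cos θ ^ 2 + Real.Angle.sin θ ^ 2 = 1 :=
  Real.Angle.cos_sq_add_sin_sq θ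

/-- `cos 0 = 1` on `AddCircle (2π)`. [folklore] -/
theorem cosA_zero : Real.Angle.cos (0 : AddCircle (2 * π)) = 1 := Real.Angle.cos_zero

/-- `sin 0 = 0` on `AddCircle (2π)`. [folklore] -/
theorem sinA_zero : Real.Angle.sin (0 : AddCircle (2 * π)) = 0 := Real.Angle.sin_zero

/-- `cos` of a real number modulo `2π`. [folklore] -/
theorem cosA_coe (x : ℝ) : Real.Angle.cos ((x : ℝ) : AddCircle (2 * π)) = Real.cos x :=
  Real.Angle.cos_coe x

/-- `sin` of a real number modulo `2π`. [folklore] -/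
theorem sinA_coe (x : ℝ) : Real.Angle.sin ((x : ℝ) : AddCircle (2 * π)) = Real.sin x :=
  Real.Angle.sin_coe x

/-- `cos` is continuous on `AddCircle (2π)`. [folklore] -/
theorem continuous_cosA : Continuous fun θ : AddCircle (2 * π) => Real.Angle.cos θ :=
  Real.Angle.continuous_cos

/-- `sin` is continuous on `AddCircle (2π)`. [folklore] -/
theorem continuous_sinA : Continuous fun θ : AddCircle (2 * π) => Real.Angle.sin θ :=
  Real.Angle.continuous_sin

/-- The angle is recovered from `(cos θ, sin θ)` by `arg`. [folklore] -/
theorem coe_arg_cosA_sinA (θ : AddCircle (2 * π)) :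
    ((arg (⟨Real.Angle.cos θ, Real.Angle.sin θ⟩ : ℂ) : ℝ) : AddCircle (2 * π)) = θ := by
  have h := Real.Angle.arg_toCircle θ
  rw [Real.Angle.coe_toCircle] at h
  have e : (⟨Real.Angle.cos θ, Real.Angle.sin θ⟩ : ℂ) =
      (Real.Angle.cos θ : ℂ) + (Real.Angle.sin θ : ℂ) * I := by
    apply Complex.ext <;> simp
  rw [e]
  exact h

/-! ## The matrices `s(z) = (√y, x/√y; 0, 1/√y)` and `k(θ) = (cos θ, sin θ; −sin θ, cos θ)` -/

/-- The upper-triangular representative `s(z) = ñ(x) ã(y) = (√y, x/√y; 0, 1/√y)` of `z = x + iy`,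
with `s(z) • i = z`. [folklore] -/
def sMat (z : ℍ) : Matrix (Fin 2) (Fin 2) ℝ :=
  !![Real.sqrt z.im, z.re / Real.sqrt z.im; 0, 1 / Real.sqrt z.im]

/-- The rotation `k(θ) = (cos θ, sin θ; −sin θ, cos θ) ∈ SO(2)`, for `θ ∈ ℝ/2πℤ`. [folklore] -/
def rotMat (θ : AddCircle (2 * π)) : Matrix (Fin 2) (Fin 2) ℝ :=
  !![Real.Angle.cos θ, Real.Angle.sin θ; -Real.Angle.sin θ, Real.Angle.cos θ]

/-- The Iwasawa map `(z, θ) ↦ s(z) k(θ)`, a bijection `ℍ × ℝ/2πℤ → SL₂(ℝ)`. [folklore] -/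
def iwasawa (p : ℍ × AddCircle (2 * π)) : Matrix (Fin 2) (Fin 2) ℝ :=
  sMat p.1 * rotMat p.2

/-- `det s(z) = 1`. [folklore] -/
theorem det_sMat (z : ℍ) : (sMat z).det = 1 := by
  have h : 0 < Real.sqrt z.im := Real.sqrt_pos.2 z.im_pos
  rw [sMat, Matrix.det_fin_two_of]
  field_simp
  ring

/-- `det k(θ) = 1`. [folklore] -/
theorem det_rotMat (θ : AddCircle (2 * π)) : (rotMat θ).det = 1 := by
  rw [rotMat, Matrix.det_fin_two_of]
  have := cosA_sq_add_sinA_sq θ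
  nlinarith [this]

/-- `det (s(z) k(θ)) = 1`. [folklore] -/
theorem det_iwasawa (p : ℍ × AddCircle (2 * π)) : (iwasawa p).det = 1 := by
  rw [iwasawa, Matrix.det_mul, det_sMat, det_rotMat, mul_one]

/-- `k` is a homomorphism: `k(θ₁ + θ₂) = k(θ₁) k(θ₂)`. [folklore] -/
theorem rotMat_add (θ₁ θ₂ : AddCircle (2 * π)) : rotMat (θ₁ + θ₂) = rotMat θ₁ * rotMat θ₂ := by
  ext i j
  fin_cases i <;> fin_cases j <;>
    simp [rotMat, Matrix.mul_apply, Fin.sum_univ_two, cosA_add, sinA_add] <;>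
    ring

/-- `k(0) = 1`. [folklore] -/
theorem rotMat_zero : rotMat 0 = 1 := by
  ext i j
  fin_cases i <;> fin_cases j <;> simp [rotMat, cosA_zero, sinA_zero]

/-! ## Coordinates on `SL₂(ℝ)`: `x(g)`, `y(g)`, `θ(g)` -/

/-- `y(g) = det g / (c² + d²)` for `g = (a b; c d)`: the imaginary part of `g • i` when `det g = 1`.
[folklore] -/
def yOf (g : Matrix (Fin 2) (Fin 2) ℝ) : ℝ := g.det / (g 1 0 ^ 2 + g 1 1 ^ 2)

/-- `x(g) = (ac + bd)/(c² + d²)`: the real part of `g • i` when `det g = 1`. [folklore] -/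
def xOf (g : Matrix (Fin 2) (Fin 2) ℝ) : ℝ := (g 0 0 * g 1 0 + g 0 1 * g 1 1) / (g 1 0 ^ 2 + g 1 1 ^ 2)

/-- `θ(g) = arg(d − i c)`: the angle of the `SO(2)`-component of `g = s(z) k(θ)`. [folklore] -/
def angleOf (g : Matrix (Fin 2) (Fin 2) ℝ) : AddCircle (2 * π) := (arg ⟨g 1 1, -g 1 0⟩ : AddCircle (2 * π))

/-- The entries of `s(z) k(θ)`. [folklore] -/
theorem iwasawa_apply (z : ℍ) (θ : AddCircle (2 * π)) :
    iwasawa (z, θ) = !![Real.sqrt z.im * Real.Angle.cos θ - z.re / Real.sqrt z.im * Real.Angle.sin θ,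
      Real.sqrt z.im * Real.Angle.sin θ + z.re / Real.sqrt z.im * Real.Angle.cos θ;
      -Real.Angle.sin θ / Real.sqrt z.im, Real.Angle.cos θ / Real.sqrt z.im] := by
  ext i j
  fin_cases i <;> fin_cases j <;> simp [iwasawa, sMat, rotMat, Matrix.mul_apply, Fin.sum_univ_two] <;>
    ring

/-- `y(s(z) k(θ)) = Im z`. [folklore] -/
theorem yOf_iwasawa (z : ℍ) (θ : AddCircle (2 * π)) : yOf (iwasawa (z, θ)) = z.im := by
  have hy : 0 < z.im := z.im_pos
  have h : 0 < Real.sqrt z.im := Real.sqrt_pos.2 hy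
  have hcs := cosA_sq_add_sinA_sq θ
  rw [yOf, det_iwasawa, iwasawa_apply]
  simp only [Matrix.of_apply, Matrix.cons_val', Matrix.cons_val_zero, Matrix.cons_val_one,
    Matrix.cons_val_fin_one]
  have : (-Real.Angle.sin θ / Real.sqrt z.im) ^ 2 + (Real.Angle.cos θ / Real.sqrt z.im) ^ 2 = 1 / z.im := by
    rw [div_pow, div_pow, neg_sq, Real.sq_sqrt hy.le, ← add_div, add_comm, hcs]
  rw [this]
  field_simp

/-- `x(s(z) k(θ)) = Re z`. [folklore] -/
theorem xOf_iwasawa (z : ℍ) (θ : AddCircle (2 * π)) : xOf (iwasawa (z, θ)) = z.re := by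
  have hy : 0 < z.im := z.im_pos
  have h : 0 < Real.sqrt z.im := Real.sqrt_pos.2 hy
  have hcs := cosA_sq_add_sinA_sq θ
  rw [xOf, iwasawa_apply]
  simp only [Matrix.of_apply, Matrix.cons_val', Matrix.cons_val_zero, Matrix.cons_val_one,
    Matrix.cons_val_fin_one]
  have hden : (-Real.Angle.sin θ / Real.sqrt z.im) ^ 2 + (Real.Angle.cos θ / Real.sqrt z.im) ^ 2 = 1 / z.im := by
    rw [div_pow, div_pow, neg_sq, Real.sq_sqrt hy.le, ← add_div, add_comm, hcs]
  have hnum : (Real.sqrt z.im * Real.Angle.cos θ - z.re / Real.sqrt z.im * Real.Angle.sin θ) * (-Real.Angle.sin θ / Real.sqrt z.im) +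
      (Real.sqrt z.im * Real.Angle.sin θ + z.re / Real.sqrt z.im * Real.Angle.cos θ) * (Real.Angle.cos θ / Real.sqrt z.im) =
      z.re / z.im := by
    field_simp
    rw [Real.sq_sqrt hy.le]
    linear_combination (z.re * z.im) * hcs
  rw [hden, hnum]
  field_simp

/-- `θ(s(z) k(θ)) = θ`. [folklore] -/
theorem angleOf_iwasawa (z : ℍ) (θ : AddCircle (2 * π)) : angleOf (iwasawa (z, θ)) = θ := by
  have hy : 0 < z.im := z.im_pos
  have h : 0 < Real.sqrt z.im := Real.sqrt_pos.2 hy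
  rw [angleOf, iwasawa_apply]
  simp only [Matrix.of_apply, Matrix.cons_val', Matrix.cons_val_zero, Matrix.cons_val_one,
    Matrix.cons_val_fin_one, neg_div, neg_neg]
  -- `arg ((cos θ + i sin θ)/√y) = arg (cos θ + i sin θ)`
  have e : (⟨Real.Angle.cos θ / Real.sqrt z.im, Real.Angle.sin θ / Real.sqrt z.im⟩ : ℂ) =
      ((Real.sqrt z.im)⁻¹ : ℝ) * (⟨Real.Angle.cos θ, Real.Angle.sin θ⟩ : ℂ) := by
    apply Complex.ext <;> simp <;> ring
  rw [e, Complex.arg_real_mul _ (inv_pos.2 h)]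
  exact coe_arg_cosA_sinA θ

/-- Uniqueness of the Iwasawa coordinates: `iwasawa` is injective. [folklore] -/
theorem iwasawa_injective : Function.Injective iwasawa := by
  rintro ⟨z, θ⟩ ⟨z', θ'⟩ h
  have hx := xOf_iwasawa z θ
  have hy := yOf_iwasawa z θ
  have hθ := angleOf_iwasawa z θ
  rw [h, xOf_iwasawa, ] at hx
  rw [h, yOf_iwasawa] at hy
  rw [h, angleOf_iwasawa] at hθ
  simp only [Prod.mk.injEq]
  exact ⟨UpperHalfPlane.ext (Complex.ext hx.symm hy.symm), hθ.symm⟩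

/-! ## The Iwasawa decomposition of `SL₂(ℝ)` -/

/-- `(a i + b)/(c i + d) = ((ac + bd) + i)/(c² + d²)` when `ad − bc = 1`. [folklore] -/
theorem moebius_I_eq (a b c d : ℝ) (hdet : a * d - b * c = 1) :
    ((a : ℂ) * I + b) / ((c : ℂ) * I + d) =
      ⟨(a * c + b * d) / (c ^ 2 + d ^ 2), 1 / (c ^ 2 + d ^ 2)⟩ := by
  have hcd : c ^ 2 + d ^ 2 ≠ 0 := by
    intro h0
    have h1 : c = 0 := by nlinarith [sq_nonneg c, sq_nonneg d]
    have h2 : d = 0 := by nlinarith [sq_nonneg c, sq_nonneg d]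
    rw [h1, h2] at hdet; simp at hdet
  have hden : (c : ℂ) * I + d ≠ 0 := by
    intro h0
    have hi := congrArg Complex.im h0
    have hr := congrArg Complex.re h0
    simp at hi hr
    apply hcd; simp [hi, hr]
  rw [div_eq_iff hden]
  apply Complex.ext
  · simp
    field_simp
    linear_combination (-c) * hdet
  · simp
    field_simp
    linear_combination d * hdet

/-- The point `z(g) = g • i ∈ ℍ` for `g ∈ SL₂(ℝ)`, in coordinates: `x(g) + i y(g)`. [folklore] -/
theorem coe_smul_I_eq (g : SL(2, ℝ)) :
    ((g • UpperHalfPlane.I : ℍ) : ℂ) = ⟨xOf g, yOf g⟩ := by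
  rw [UpperHalfPlane.coe_specialLinearGroup_apply]
  have halg : ∀ r : ℝ, algebraMap ℝ ℝ r = r := fun r => rfl
  simp only [halg, UpperHalfPlane.coe_I]
  have hdet : (g : Matrix (Fin 2) (Fin 2) ℝ).det = 1 := g.det_coe
  have hdet' := hdet
  rw [Matrix.det_fin_two] at hdet'
  rw [moebius_I_eq _ _ _ _ hdet']
  simp only [xOf, yOf, hdet]

/-- `s(z)` as an element of `SL₂(ℝ)`. [folklore] -/
def sMatSL (z : ℍ) : SL(2, ℝ) := ⟨sMat z, det_sMat z⟩

/-- `s(z) • i = z`. [folklore] -/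
theorem sMatSL_smul_I (z : ℍ) : sMatSL z • UpperHalfPlane.I = z := by
  apply UpperHalfPlane.ext
  rw [coe_smul_I_eq]
  have e : ((sMatSL z : SL(2, ℝ)) : Matrix (Fin 2) (Fin 2) ℝ) = iwasawa (z, 0) := by
    simp [sMatSL, iwasawa, rotMat_zero]
  rw [e, xOf_iwasawa, yOf_iwasawa]
  apply Complex.ext <;> simp

/-- An element of `SL₂(ℝ)` fixing `i` is the rotation by its angle: `g = k(θ(g))`. [folklore] -/
theorem eq_rotMat_of_smul_I_eq (g : SL(2, ℝ)) (hg : g • UpperHalfPlane.I = UpperHalfPlane.I) :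
    (g : Matrix (Fin 2) (Fin 2) ℝ) = rotMat (angleOf g) := by
  have h := congrArg (fun w : ℍ => (w : ℂ)) hg
  simp only [coe_smul_I_eq, UpperHalfPlane.coe_I] at h
  have hx : xOf g = 0 := by simpa using congrArg Complex.re h
  have hy : yOf g = 1 := by simpa using congrArg Complex.im h
  have hdet : (g : Matrix (Fin 2) (Fin 2) ℝ).det = 1 := g.det_coe
  set a : ℝ := g 0 0 with ha
  set b : ℝ := g 0 1 with hb
  set c : ℝ := g 1 0 with hc
  set d : ℝ := g 1 1 with hd
  have hdet' : a * d - b * c = 1 := by rw [← hdet, Matrix.det_fin_two]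
  have hcd : c ^ 2 + d ^ 2 = 1 := by
    have : yOf g = 1 / (c ^ 2 + d ^ 2) := by simp [yOf, hdet, hc, hd]
    rw [this] at hy
    have hne : c ^ 2 + d ^ 2 ≠ 0 := by
      intro h0; rw [h0] at hy; simp at hy
    field_simp at hy
    linarith
  have hx' : a * c + b * d = 0 := by
    have : xOf g = (a * c + b * d) / (c ^ 2 + d ^ 2) := by simp [xOf, ha, hb, hc, hd]
    rw [this, hcd, div_one] at hx
    exact hx
  -- solve: `a = d`, `b = -c`
  have had : a = d := by nlinarith [hdet', hx', hcd, sq_nonneg (a - d), sq_nonneg (b + c)]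
  have hbc : b = -c := by nlinarith [hdet', hx', hcd, sq_nonneg (a - d), sq_nonneg (b + c)]
  -- the angle
  have hw : (⟨d, -c⟩ : ℂ) ≠ 0 := by
    intro h0
    have h1 := congrArg Complex.re h0
    have h2 := congrArg Complex.im h0
    simp at h1 h2
    rw [h1, h2] at hcd; simp at hcd
  have hnorm : ‖(⟨d, -c⟩ : ℂ)‖ = 1 := by
    rw [Complex.norm_eq_sqrt_sq_add_sq]
    simp only
    rw [show d ^ 2 + (-c) ^ 2 = 1 by nlinarith [hcd], Real.sqrt_one]
  have hcos : Real.Angle.cos (angleOf g) = d := by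
    have e : Real.Angle.cos (angleOf g) = Real.cos (arg (⟨d, -c⟩ : ℂ)) := cosA_coe _
    rw [e, Complex.cos_arg hw, hnorm, div_one]
  have hsin : Real.Angle.sin (angleOf g) = -c := by
    have e : Real.Angle.sin (angleOf g) = Real.sin (arg (⟨d, -c⟩ : ℂ)) := sinA_coe _
    rw [e, Complex.sin_arg, hnorm, div_one]
  ext i j
  fin_cases i <;> fin_cases j
  · simp [rotMat, hcos, ← ha, had]
  · simp [rotMat, hsin, ← hb, hbc]
  · simp [rotMat, hsin, ← hc]
  · simp [rotMat, hcos, ← hd]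

/-- **Iwasawa decomposition**: every `g ∈ SL₂(ℝ)` is `s(g • i) · k(θ(g))`. [folklore] -/
theorem eq_iwasawa (g : SL(2, ℝ)) :
    (g : Matrix (Fin 2) (Fin 2) ℝ) = iwasawa (g • UpperHalfPlane.I, angleOf g) := by
  set z : ℍ := g • UpperHalfPlane.I with hz
  set K : SL(2, ℝ) := (sMatSL z)⁻¹ * g with hK
  have hKI : K • UpperHalfPlane.I = UpperHalfPlane.I := by
    rw [hK, mul_smul, ← hz, inv_smul_eq_iff, sMatSL_smul_I]
  have hKrot := eq_rotMat_of_smul_I_eq K hKI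
  have hg : g = sMatSL z * K := by rw [hK, mul_inv_cancel_left]
  have hgm : (g : Matrix (Fin 2) (Fin 2) ℝ) = iwasawa (z, angleOf K) := by
    conv_lhs => rw [hg, Matrix.SpecialLinearGroup.coe_mul, hKrot]
    rfl
  rw [hgm, angleOf_iwasawa]

/-- The range of the Iwasawa map is `SL₂(ℝ) = {det = 1}`. [folklore] -/
theorem range_iwasawa : Set.range iwasawa = {g | g.det = 1} := by
  ext g
  constructor
  · rintro ⟨p, rfl⟩; exact det_iwasawa p
  · intro hg
    exact ⟨_, (eq_iwasawa ⟨g, hg⟩).symm⟩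

/-- **Equivariance**: `h · s(z) k(θ) = s(h • z) · k(θ(h s(z)) + θ)` for `h ∈ SL₂(ℝ)`. [folklore] -/
theorem mul_iwasawa (h : SL(2, ℝ)) (z : ℍ) (θ : AddCircle (2 * π)) :
    (h : Matrix (Fin 2) (Fin 2) ℝ) * iwasawa (z, θ) =
      iwasawa (h • z, angleOf ((h : Matrix (Fin 2) (Fin 2) ℝ) * sMat z) + θ) := by
  have hdec : (h : Matrix (Fin 2) (Fin 2) ℝ) * sMat z =
      sMat (h • z) * rotMat (angleOf ((h : Matrix (Fin 2) (Fin 2) ℝ) * sMat z)) := by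
    have := eq_iwasawa (h * sMatSL z)
    rw [mul_smul, sMatSL_smul_I, Matrix.SpecialLinearGroup.coe_mul] at this
    exact this
  calc (h : Matrix (Fin 2) (Fin 2) ℝ) * iwasawa (z, θ)
      = (h : Matrix (Fin 2) (Fin 2) ℝ) * sMat z * rotMat θ := by
        rw [iwasawa, Matrix.mul_assoc]
    _ = sMat (h • z) * rotMat (angleOf ((h : Matrix (Fin 2) (Fin 2) ℝ) * sMat z)) * rotMat θ := by
        nth_rewrite 1 [hdec]; rfl
    _ = iwasawa (h • z, angleOf ((h : Matrix (Fin 2) (Fin 2) ℝ) * sMat z) + θ) := by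
        rw [iwasawa, rotMat_add, Matrix.mul_assoc]

/-! ## The skew-product structure of left multiplication -/

/-- Left multiplication by `h ∈ SL₂(ℝ)` in Iwasawa coordinates: `(z, θ) ↦ (h • z, θ(h s(z)) + θ)`.
[folklore] -/
def skewMap (h : SL(2, ℝ)) (p : ℍ × AddCircle (2 * π)) : ℍ × AddCircle (2 * π) :=
  (h • p.1, angleOf ((h : Matrix (Fin 2) (Fin 2) ℝ) * sMat p.1) + p.2)

/-- `iwasawa ∘ skewMap h = (h · ) ∘ iwasawa`. [folklore] -/
theorem iwasawa_skewMap (h : SL(2, ℝ)) (p : ℍ × AddCircle (2 * π)) :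
    iwasawa (skewMap h p) = (h : Matrix (Fin 2) (Fin 2) ℝ) * iwasawa p := by
  rcases p with ⟨z, θ⟩
  rw [skewMap, mul_iwasawa]

/-- `z ↦ s(z)` is continuous. [folklore] -/
theorem continuous_sMat : Continuous sMat := by
  refine continuous_matrix fun i j => ?_
  have hre : Continuous fun z : ℍ => z.re := Complex.continuous_re.comp UpperHalfPlane.continuous_coe
  have him : Continuous fun z : ℍ => z.im := UpperHalfPlane.continuous_im
  have hsq : Continuous fun z : ℍ => Real.sqrt z.im := Real.continuous_sqrt.comp him
  have hne : ∀ z : ℍ, Real.sqrt z.im ≠ 0 := fun z => (Real.sqrt_pos.2 z.im_pos).ne'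
  fin_cases i <;> fin_cases j
  · exact hsq
  · exact hre.div hsq hne
  · exact continuous_const
  · exact continuous_const.div hsq hne

/-- `θ ↦ k(θ)` is continuous. [folklore] -/
theorem continuous_rotMat : Continuous rotMat := by
  refine continuous_matrix fun i j => ?_
  fin_cases i <;> fin_cases j
  · exact continuous_cosA
  · exact continuous_sinA
  · exact continuous_sinA.neg
  · exact continuous_cosA

/-- The Iwasawa map is continuous. [folklore] -/
theorem continuous_iwasawa : Continuous iwasawa :=
  (continuous_sMat.comp continuous_fst).matrix_mul (continuous_rotMat.comp continuous_snd)

section Measurable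

variable [MeasurableSpace (Matrix (Fin 2) (Fin 2) ℝ)] [BorelSpace (Matrix (Fin 2) (Fin 2) ℝ)]

omit [MeasurableSpace (Matrix (Fin 2) (Fin 2) ℝ)] [BorelSpace (Matrix (Fin 2) (Fin 2) ℝ)] in
/-- `g ↦ d − i c` (for `g = (a b; c d)`) is continuous. [folklore] -/
theorem continuous_rowComplex :
    Continuous fun M : Matrix (Fin 2) (Fin 2) ℝ => (⟨M 1 1, -M 1 0⟩ : ℂ) := by
  have h11 : Continuous fun M : Matrix (Fin 2) (Fin 2) ℝ => M 1 1 :=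
    Continuous.matrix_elem continuous_id 1 1
  have h10 : Continuous fun M : Matrix (Fin 2) (Fin 2) ℝ => M 1 0 :=
    Continuous.matrix_elem continuous_id 1 0
  have e : (fun M : Matrix (Fin 2) (Fin 2) ℝ => (⟨M 1 1, -M 1 0⟩ : ℂ)) =
      fun M => ((M 1 1 : ℝ) : ℂ) + ((-M 1 0 : ℝ) : ℂ) * Complex.I := by
    funext M
    apply Complex.ext <;> simp
  rw [e]
  exact (Complex.continuous_ofReal.comp h11).add
    ((Complex.continuous_ofReal.comp h10.neg).mul continuous_const)

/-- The angle coordinate is measurable. [folklore] -/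
theorem measurable_angleOf : Measurable angleOf :=
  (AddCircle.continuous_mk' (2 * π)).measurable.comp
    (Complex.measurable_arg.comp continuous_rowComplex.measurable)

/-- The Iwasawa map is measurable. [folklore] -/
theorem measurable_iwasawa : Measurable iwasawa := continuous_iwasawa.measurable

/-- The skew map is measurable. [folklore] -/
theorem measurable_skewMap (h : SL(2, ℝ)) : Measurable (skewMap h) := by
  have hA : Measurable fun z : ℍ => angleOf ((h : Matrix (Fin 2) (Fin 2) ℝ) * sMat z) :=
    measurable_angleOf.comp (continuous_const.matrix_mul continuous_sMat).measurable
  have h1 : Measurable fun p : ℍ × AddCircle (2 * π) => h • p.1 :=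
    (continuous_const_smul (Matrix.SpecialLinearGroup.toGL h : GL (Fin 2) ℝ)).measurable.comp
      measurable_fst
  exact h1.prodMk ((hA.comp measurable_fst).add measurable_snd)

/-- **Left multiplication is a measure-preserving skew product** in Iwasawa coordinates: the base
map `z ↦ h • z` preserves the hyperbolic measure of `ℍ` (Mathlib) and the fibre maps are rotations
of the circle. [folklore] -/
theorem measurePreserving_skewMap (h : SL(2, ℝ)) :
    MeasurePreserving (skewMap h) ((volume : Measure ℍ).prod (volume : Measure (AddCircle (2 * π))))
      ((volume : Measure ℍ).prod (volume : Measure (AddCircle (2 * π)))) := by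
  have hf : MeasurePreserving (fun z : ℍ => h • z) (volume : Measure ℍ) volume :=
    measurePreserving_smul (Matrix.SpecialLinearGroup.toGL h : GL (Fin 2) ℝ) (volume : Measure ℍ)
  have hA : Measurable fun z : ℍ => angleOf ((h : Matrix (Fin 2) (Fin 2) ℝ) * sMat z) :=
    measurable_angleOf.comp (continuous_const.matrix_mul continuous_sMat).measurable
  have hgm : Measurable (Function.uncurry fun (z : ℍ) (θ : AddCircle (2 * π)) =>
      angleOf ((h : Matrix (Fin 2) (Fin 2) ℝ) * sMat z) + θ) :=
    (hA.comp measurable_fst).add measurable_snd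
  have hg : ∀ᵐ z : ℍ ∂volume, Measure.map (fun θ : AddCircle (2 * π) =>
      angleOf ((h : Matrix (Fin 2) (Fin 2) ℝ) * sMat z) + θ) volume = volume :=
    ae_of_all _ fun z => (measurePreserving_add_left volume _).map_eq
  exact hf.skew_product hgm hg

/-- **The left Haar measure of `SL₂(ℝ)` in Iwasawa coordinates**: the push-forward of
`(dx dy / y²) ⊗ dθ` on `ℍ × ℝ/2πℤ` along `(z, θ) ↦ s(z) k(θ)`, a measure on `M₂(ℝ)` carried by
`SL₂(ℝ)`. [folklore] -/
def iwasawaMeasure : Measure (Matrix (Fin 2) (Fin 2) ℝ) :=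
  Measure.map iwasawa ((volume : Measure ℍ).prod (volume : Measure (AddCircle (2 * π))))

/-- The Iwasawa measure of a measurable set is the product measure of its coordinate preimage.
[folklore] -/
theorem iwasawaMeasure_apply {E : Set (Matrix (Fin 2) (Fin 2) ℝ)} (hE : MeasurableSet E) :
    iwasawaMeasure E = ((volume : Measure ℍ).prod (volume : Measure (AddCircle (2 * π)))) (iwasawa ⁻¹' E) := by
  rw [iwasawaMeasure, Measure.map_apply measurable_iwasawa hE]

/-- The Iwasawa measure is carried by `SL₂(ℝ)`. [folklore] -/
theorem iwasawaMeasure_compl_det_one : iwasawaMeasure {g | g.det = 1}ᶜ = 0 := by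
  have hm : MeasurableSet {g : Matrix (Fin 2) (Fin 2) ℝ | g.det = 1} :=
    (continuous_id.matrix_det.measurable) (measurableSet_singleton 1)
  rw [iwasawaMeasure_apply hm.compl]
  have : iwasawa ⁻¹' {g : Matrix (Fin 2) (Fin 2) ℝ | g.det = 1}ᶜ = ∅ := by
    ext p; simp [det_iwasawa p]
  rw [this, measure_empty]

/-- Left multiplication by a fixed matrix is measurable. [folklore] -/
theorem measurable_mul_left (h : Matrix (Fin 2) (Fin 2) ℝ) :
    Measurable fun g : Matrix (Fin 2) (Fin 2) ℝ => h * g :=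
  (continuous_const.matrix_mul continuous_id).measurable

/-- **Left invariance under `SL₂(ℝ)`** of the Iwasawa measure. [folklore] -/
theorem map_mul_left_iwasawaMeasure (h : SL(2, ℝ)) :
    Measure.map (fun g => (h : Matrix (Fin 2) (Fin 2) ℝ) * g) iwasawaMeasure = iwasawaMeasure := by
  rw [iwasawaMeasure, Measure.map_map (measurable_mul_left _) measurable_iwasawa]
  have : (fun g => (h : Matrix (Fin 2) (Fin 2) ℝ) * g) ∘ iwasawa = iwasawa ∘ skewMap h :=
    funext fun p => (iwasawa_skewMap h p).symm
  rw [this, ← Measure.map_map measurable_iwasawa (measurable_skewMap h),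
    (measurePreserving_skewMap h).map_eq]

/-- The reflection `σ = diag(1, −1)`, of determinant `−1`. [folklore] -/
def sigmaMat : Matrix (Fin 2) (Fin 2) ℝ := !![1, 0; 0, -1]

omit [MeasurableSpace (Matrix (Fin 2) (Fin 2) ℝ)] [BorelSpace (Matrix (Fin 2) (Fin 2) ℝ)] in
/-- `σ² = 1`. [folklore] -/
theorem sigmaMat_mul_sigmaMat : sigmaMat * sigmaMat = 1 := by
  ext i j; fin_cases i <;> fin_cases j <;> simp [sigmaMat, Matrix.mul_apply, Fin.sum_univ_two]

omit [MeasurableSpace (Matrix (Fin 2) (Fin 2) ℝ)] [BorelSpace (Matrix (Fin 2) (Fin 2) ℝ)] in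
/-- `det σ = −1`. [folklore] -/
theorem det_sigmaMat : sigmaMat.det = -1 := by
  simp [sigmaMat, Matrix.det_fin_two_of]

/-- **The Haar measure of `SL₂^±(ℝ) = {det = ±1}`**: the Iwasawa measure plus its translate by
`σ = diag(1, −1)`; in coordinates `y⁻² dx dy dθ` on each of the two components. [folklore] -/
def haarSL2pm : Measure (Matrix (Fin 2) (Fin 2) ℝ) :=
  iwasawaMeasure + Measure.map (fun g => sigmaMat * g) iwasawaMeasure

omit [MeasurableSpace (Matrix (Fin 2) (Fin 2) ℝ)] [BorelSpace (Matrix (Fin 2) (Fin 2) ℝ)] in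
/-- Conjugating an element of `SL₂(ℝ)` by `σ` stays in `SL₂(ℝ)`. [folklore] -/
theorem det_sigmaMat_mul_mul_sigmaMat {h : Matrix (Fin 2) (Fin 2) ℝ} (hh : h.det = 1) :
    (sigmaMat * h * sigmaMat).det = 1 := by
  rw [Matrix.det_mul, Matrix.det_mul, det_sigmaMat, hh]; norm_num

/-- Left invariance of `haarSL2pm` under `SL₂(ℝ)`. [folklore] -/
theorem map_mul_left_haarSL2pm_of_det_one {h : Matrix (Fin 2) (Fin 2) ℝ} (hh : h.det = 1) :
    Measure.map (fun g => h * g) haarSL2pm = haarSL2pm := by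
  have h1 := map_mul_left_iwasawaMeasure ⟨h, hh⟩
  have h2 := map_mul_left_iwasawaMeasure ⟨sigmaMat * h * sigmaMat, det_sigmaMat_mul_mul_sigmaMat hh⟩
  rw [haarSL2pm, Measure.map_add _ _ (measurable_mul_left h), h1,
    Measure.map_map (measurable_mul_left h) (measurable_mul_left sigmaMat)]
  have e : (fun g => h * g) ∘ (fun g => sigmaMat * g) =
      (fun g => sigmaMat * g) ∘ fun g => sigmaMat * h * sigmaMat * g := by
    funext g
    simp only [Function.comp_apply, ← Matrix.mul_assoc, sigmaMat_mul_sigmaMat, Matrix.one_mul]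
  rw [e, ← Measure.map_map (measurable_mul_left sigmaMat) (measurable_mul_left _), h2]

/-- Left invariance of `haarSL2pm` under `σ`. [folklore] -/
theorem map_sigmaMat_mul_haarSL2pm :
    Measure.map (fun g => sigmaMat * g) haarSL2pm = haarSL2pm := by
  rw [haarSL2pm, Measure.map_add _ _ (measurable_mul_left sigmaMat),
    Measure.map_map (measurable_mul_left sigmaMat) (measurable_mul_left sigmaMat)]
  have e : (fun g => sigmaMat * g) ∘ (fun g => sigmaMat * g) = id := by
    funext g; simp [← Matrix.mul_assoc, sigmaMat_mul_sigmaMat]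
  rw [e, Measure.map_id, add_comm]

/-- **Left invariance of the Haar measure of `SL₂^±(ℝ)`** under every matrix of determinant
`±1`. [folklore] -/
theorem map_mul_left_haarSL2pm {h : Matrix (Fin 2) (Fin 2) ℝ} (hh : h.det = 1 ∨ h.det = -1) :
    Measure.map (fun g => h * g) haarSL2pm = haarSL2pm := by
  rcases hh with hh | hh
  · exact map_mul_left_haarSL2pm_of_det_one hh
  · have hh' : (sigmaMat * h).det = 1 := by rw [Matrix.det_mul, det_sigmaMat, hh]; norm_num
    have e : (fun g => h * g) = (fun g => sigmaMat * g) ∘ fun g => sigmaMat * h * g := by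
      funext g
      simp only [Function.comp_apply]
      rw [← Matrix.mul_assoc, ← Matrix.mul_assoc, sigmaMat_mul_sigmaMat, Matrix.one_mul]
    rw [e, ← Measure.map_map (measurable_mul_left sigmaMat) (measurable_mul_left _),
      map_mul_left_haarSL2pm_of_det_one hh', map_sigmaMat_mul_haarSL2pm]

/-- Translation invariance on sets: `μ(h · E) = μ(E)` via preimages, `μ({g | h g ∈ E}) = μ(E)`, for
`det h = ±1`. [folklore] -/
theorem haarSL2pm_preimage_mul_left {h : Matrix (Fin 2) (Fin 2) ℝ} (hh : h.det = 1 ∨ h.det = -1)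
    {E : Set (Matrix (Fin 2) (Fin 2) ℝ)} (hE : MeasurableSet E) :
    haarSL2pm ((fun g => h * g) ⁻¹' E) = haarSL2pm E := by
  rw [← Measure.map_apply (measurable_mul_left h) hE, map_mul_left_haarSL2pm hh]

/-- On subsets of `SL₂(ℝ)` the Haar measure of `SL₂^±(ℝ)` is the Iwasawa measure, i.e. the product
measure of the coordinate preimage. [folklore] -/
theorem haarSL2pm_apply_of_subset {E : Set (Matrix (Fin 2) (Fin 2) ℝ)} (hE : MeasurableSet E)
    (hE1 : E ⊆ {g | g.det = 1}) :
    haarSL2pm E = ((volume : Measure ℍ).prod (volume : Measure (AddCircle (2 * π)))) (iwasawa ⁻¹' E) := by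
  rw [haarSL2pm, Measure.add_apply, Measure.map_apply (measurable_mul_left _) hE,
    iwasawaMeasure_apply hE, iwasawaMeasure_apply ((measurable_mul_left _) hE)]
  have : iwasawa ⁻¹' ((fun g => sigmaMat * g) ⁻¹' E) = ∅ := by
    ext p
    simp only [Set.mem_preimage, Set.mem_empty_iff_false, iff_false]
    intro hp
    have := hE1 hp
    simp only [Set.mem_setOf_eq, Matrix.det_mul, det_sigmaMat, det_iwasawa] at this
    norm_num at this
  rw [this, measure_empty, add_zero]

/-- The Haar measure of `SL₂^±(ℝ)` is carried by `{det = ±1}`. [folklore] -/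
theorem haarSL2pm_compl : haarSL2pm {g | g.det = 1 ∨ g.det = -1}ᶜ = 0 := by
  have hm : MeasurableSet {g : Matrix (Fin 2) (Fin 2) ℝ | g.det = 1 ∨ g.det = -1} := by
    have h1 : MeasurableSet {g : Matrix (Fin 2) (Fin 2) ℝ | g.det = 1} :=
      (continuous_id.matrix_det.measurable) (measurableSet_singleton 1)
    have h2 : MeasurableSet {g : Matrix (Fin 2) (Fin 2) ℝ | g.det = -1} :=
      (continuous_id.matrix_det.measurable) (measurableSet_singleton (-1))
    exact h1.union h2
  rw [haarSL2pm, Measure.add_apply, Measure.map_apply (measurable_mul_left _) hm.compl,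
    iwasawaMeasure_apply hm.compl, iwasawaMeasure_apply ((measurable_mul_left _) hm.compl)]
  have e1 : iwasawa ⁻¹' {g : Matrix (Fin 2) (Fin 2) ℝ | g.det = 1 ∨ g.det = -1}ᶜ = ∅ := by
    ext p; simp [det_iwasawa p]
  have e2 : iwasawa ⁻¹' ((fun g => sigmaMat * g) ⁻¹'
      {g : Matrix (Fin 2) (Fin 2) ℝ | g.det = 1 ∨ g.det = -1}ᶜ) = ∅ := by
    ext p; simp [Matrix.det_mul, det_sigmaMat, det_iwasawa p]
  rw [e1, e2, measure_empty, add_zero]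

/-! ## Coordinate sets and their Haar measure -/

omit [MeasurableSpace (Matrix (Fin 2) (Fin 2) ℝ)] [BorelSpace (Matrix (Fin 2) (Fin 2) ℝ)] in
/-- An arc of the circle `ℝ/2πℤ`: the image of `[a, b)`. [folklore] -/
def arc (a b : ℝ) : Set (AddCircle (2 * π)) := ((↑) : ℝ → AddCircle (2 * π)) '' Set.Ico a b

omit [MeasurableSpace (Matrix (Fin 2) (Fin 2) ℝ)] [BorelSpace (Matrix (Fin 2) (Fin 2) ℝ)] in
/-- For `b ≤ a + 2π`, the arc `[a, b)` is the preimage of `{s < b}` under the fundamental-interval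
coordinate `equivIco : ℝ/2πℤ ≃ [a, a + 2π)`. [folklore] -/
theorem arc_eq_preimage_equivIco {a b : ℝ} (h2 : b ≤ a + 2 * π) :
    arc a b = (AddCircle.equivIco (2 * π) a) ⁻¹' {s | (s : ℝ) < b} := by
  ext θ
  constructor
  · rintro ⟨x, hx, rfl⟩
    simp only [Set.mem_preimage, Set.mem_setOf_eq]
    rw [AddCircle.equivIco_coe_eq ⟨hx.1, by linarith [hx.2]⟩]
    exact hx.2
  · intro hθ
    simp only [Set.mem_preimage, Set.mem_setOf_eq] at hθ
    refine ⟨(AddCircle.equivIco (2 * π) a θ : ℝ), ⟨(AddCircle.equivIco (2 * π) a θ).2.1, hθ⟩, ?_⟩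
    exact (AddCircle.equivIco (2 * π) a).symm_apply_apply θ

omit [MeasurableSpace (Matrix (Fin 2) (Fin 2) ℝ)] [BorelSpace (Matrix (Fin 2) (Fin 2) ℝ)] in
/-- Arcs are measurable. [folklore] -/
theorem measurableSet_arc {a b : ℝ} (h2 : b ≤ a + 2 * π) : MeasurableSet (arc a b) := by
  rw [arc_eq_preimage_equivIco h2]
  exact (AddCircle.measurableEquivIco (2 * π) a).measurable
    (measurableSet_lt measurable_subtype_coe measurable_const)

omit [MeasurableSpace (Matrix (Fin 2) (Fin 2) ℝ)] [BorelSpace (Matrix (Fin 2) (Fin 2) ℝ)] in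
/-- **The measure of an arc is its length**: `vol([a, b)) = b − a` for `0 ≤ b − a < 2π`.
[folklore] -/
theorem volume_arc {a b : ℝ} (h2 : b < a + 2 * π) :
    volume (arc a b) = ENNReal.ofReal (b - a) := by
  have hm := measurableSet_arc h2.le
  rw [AddCircle.add_projection_respects_measure (2 * π) (b - 2 * π) hm]
  have e : ((↑) : ℝ → AddCircle (2 * π)) ⁻¹' arc a b ∩ Set.Ioc (b - 2 * π) (b - 2 * π + 2 * π) =
      Set.Ico a b := by
    ext x
    simp only [Set.mem_inter_iff, Set.mem_preimage, Set.mem_Ioc, Set.mem_Ico]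
    constructor
    · rintro ⟨⟨x', hx', hxx'⟩, h1, h2'⟩
      -- `x' ≡ x (mod 2π)` with both in the window `(b - 2π, b]`
      rw [AddCircle.coe_eq_coe_iff_of_mem_Ioc (p := 2 * π) (a := b - 2 * π)
        ⟨by linarith [hx'.1], by linarith [hx'.2]⟩ ⟨h1, h2'⟩] at hxx'
      rw [← hxx']; exact hx'
    · rintro ⟨h1, h2'⟩
      exact ⟨⟨x, ⟨h1, h2'⟩, rfl⟩, by linarith, by linarith⟩
  rw [e, Real.volume_Ico]

/-- The complex coordinate `w(g) = x(g) + i y(g)` is measurable. [folklore] -/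
theorem measurable_coordC : Measurable fun g : Matrix (Fin 2) (Fin 2) ℝ => (⟨xOf g, yOf g⟩ : ℂ) := by
  have hent : ∀ i j, Measurable fun g : Matrix (Fin 2) (Fin 2) ℝ => g i j := fun i j =>
    (Continuous.matrix_elem continuous_id i j).measurable
  have hx : Measurable xOf := by
    unfold xOf
    exact (((hent 0 0).mul (hent 1 0)).add ((hent 0 1).mul (hent 1 1))).div
      (((hent 1 0).pow_const 2).add ((hent 1 1).pow_const 2))
  have hy : Measurable yOf := by
    unfold yOf
    exact (continuous_id.matrix_det.measurable).div
      (((hent 1 0).pow_const 2).add ((hent 1 1).pow_const 2))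
  have e : (fun g : Matrix (Fin 2) (Fin 2) ℝ => (⟨xOf g, yOf g⟩ : ℂ)) =
      fun g => (xOf g : ℂ) + (yOf g : ℂ) * I := by
    funext g; apply Complex.ext <;> simp
  rw [e]
  exact (Complex.measurable_ofReal.comp hx).add ((Complex.measurable_ofReal.comp hy).mul_const I)

/-- The coordinate set `{g ∈ SL₂(ℝ) : x(g) + i y(g) ∈ A, θ(g) ∈ Θ}`. [folklore] -/
def coordSet (A : Set ℂ) (Θ : Set (AddCircle (2 * π))) : Set (Matrix (Fin 2) (Fin 2) ℝ) :=
  {g | g.det = 1 ∧ (⟨xOf g, yOf g⟩ : ℂ) ∈ A ∧ angleOf g ∈ Θ}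

omit [MeasurableSpace (Matrix (Fin 2) (Fin 2) ℝ)] [BorelSpace (Matrix (Fin 2) (Fin 2) ℝ)] in
/-- Coordinate sets lie in `SL₂(ℝ)`. [folklore] -/
theorem coordSet_subset (A : Set ℂ) (Θ : Set (AddCircle (2 * π))) : coordSet A Θ ⊆ {g | g.det = 1} :=
  fun _ hg => hg.1

/-- Coordinate sets are measurable. [folklore] -/
theorem measurableSet_coordSet {A : Set ℂ} (hA : MeasurableSet A) {Θ : Set (AddCircle (2 * π))}
    (hΘ : MeasurableSet Θ) : MeasurableSet (coordSet A Θ) := by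
  have h1 : MeasurableSet {g : Matrix (Fin 2) (Fin 2) ℝ | g.det = 1} :=
    (continuous_id.matrix_det.measurable) (measurableSet_singleton 1)
  exact h1.inter ((measurable_coordC hA).inter (measurable_angleOf hΘ))

omit [MeasurableSpace (Matrix (Fin 2) (Fin 2) ℝ)] [BorelSpace (Matrix (Fin 2) (Fin 2) ℝ)] in
/-- The Iwasawa preimage of a coordinate set is the product set. [folklore] -/
theorem iwasawa_preimage_coordSet (A : Set ℂ) (Θ : Set (AddCircle (2 * π))) :
    iwasawa ⁻¹' coordSet A Θ = (((↑) : ℍ → ℂ) ⁻¹' A) ×ˢ Θ := by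
  ext ⟨z, θ⟩
  simp only [coordSet, Set.mem_preimage, Set.mem_setOf_eq, det_iwasawa, xOf_iwasawa, yOf_iwasawa,
    angleOf_iwasawa, true_and, Set.mem_prod]
  have : (⟨z.re, z.im⟩ : ℂ) = (z : ℂ) := Complex.ext rfl rfl
  rw [this]

omit [MeasurableSpace (Matrix (Fin 2) (Fin 2) ℝ)] [BorelSpace (Matrix (Fin 2) (Fin 2) ℝ)] in
/-- Every element of `SL₂(ℝ)` lies in the coordinate set of its coordinates. [folklore] -/
theorem mem_coordSet_iff {A : Set ℂ} {Θ : Set (AddCircle (2 * π))} {g : Matrix (Fin 2) (Fin 2) ℝ} :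
    g ∈ coordSet A Θ ↔ g.det = 1 ∧ (⟨xOf g, yOf g⟩ : ℂ) ∈ A ∧ angleOf g ∈ Θ := Iff.rfl

/-- **The Haar measure of a coordinate set is the product of the hyperbolic area and the arc
length**: `μ{g ∈ SL₂(ℝ) : g • i ∈ A, θ(g) ∈ Θ} = vol_ℍ(A) · |Θ|`. [folklore] -/
theorem haarSL2pm_coordSet {A : Set ℂ} (hA : MeasurableSet A) {Θ : Set (AddCircle (2 * π))}
    (hΘ : MeasurableSet Θ) :
    haarSL2pm (coordSet A Θ) = volume (((↑) : ℍ → ℂ) ⁻¹' A) * volume Θ := by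
  rw [haarSL2pm_apply_of_subset (measurableSet_coordSet hA hΘ) (coordSet_subset A Θ),
    iwasawa_preimage_coordSet, Measure.prod_prod]

omit [MeasurableSpace (Matrix (Fin 2) (Fin 2) ℝ)] [BorelSpace (Matrix (Fin 2) (Fin 2) ℝ)] in
/-- For `y > 0`, Mathlib's density `(1/‖y‖₊)²` of the hyperbolic measure is `ofReal (1 / y²)`.
[folklore] -/
theorem ennreal_one_div_nnnorm_sq {y : ℝ} (hy : 0 < y) :
    (((1 / ‖y‖₊) ^ 2 : NNReal) : ENNReal) = ENNReal.ofReal (1 / y ^ 2) := by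
  rw [ENNReal.ofReal, ENNReal.coe_inj]
  apply NNReal.coe_injective
  have h1 : (‖y‖₊ : ℝ) = y := by simp [abs_of_pos hy]
  simp only [NNReal.coe_pow, NNReal.coe_div, NNReal.coe_one, h1]
  rw [Real.coe_toNNReal _ (by positivity)]
  field_simp

omit [MeasurableSpace (Matrix (Fin 2) (Fin 2) ℝ)] [BorelSpace (Matrix (Fin 2) (Fin 2) ℝ)] in
/-- **The hyperbolic area in coordinates**: for a measurable `A ⊆ {Im > 0} ⊂ ℂ`,
`vol_ℍ(A) = ∫_A dx dy / y²`. [folklore] -/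
theorem volume_coe_preimage {A : Set ℂ} (hA : MeasurableSet A) (hA' : A ⊆ {w | 0 < w.im}) :
    volume (((↑) : ℍ → ℂ) ⁻¹' A) = ∫⁻ w in A, ENNReal.ofReal (1 / w.im ^ 2) := by
  rw [UpperHalfPlane.volume_eq_lintegral]
  have e : ((↑) : ℍ → ℂ) '' (((↑) : ℍ → ℂ) ⁻¹' A) = A := by
    rw [Set.image_preimage_eq_inter_range]
    apply Set.inter_eq_left.2
    intro w hw
    exact ⟨⟨w, hA' hw⟩, rfl⟩
  rw [e]
  apply setLIntegral_congr_fun hA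
  intro w hw
  exact ennreal_one_div_nnnorm_sq (hA' hw)

end Measurable

end Literature.MeasureTheory.Group



end
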